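import Summits.BirchSwinnertonDyer.BirchSwinnertonDyer.Theses.UniversalToricDescent
import Summits.BirchSwinnertonDyer.BirchSwinnertonDyer.Theorems.UniversalToricDescentTwinDegreeFrameAtThreeMultTresTOfSelfDualMemberTower
import HarnessLib

/-!
# SKELETON v17 (line `membertower`, crux ♭B′° `TwinDegreeFrameAtThreeMultTresT` = stmt-BirchSwinnertonDyer-22539 ONLY; width seat
# bsd-wall-utd-b-w1 g0, 2026-08-29) — v16 (LEAD utd-p2 g18, sha16 8c09f9fed2825b17) with `stub_thmB` REMOVED

v17 = v16 MINUS `stub_thmB` (Hsieh 2014 Thm B, item 20711, PUB BY NAME), for the degree-only crux 22539 ALONE. Reason (landed kernel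
p680907 `UniversalToricDescentTwinDegreeFrameAtThreeMultTresTOfSelfDualMemberTower`): in (4)†/(5)† Hsieh Thm B is used only for
`μ(L) = 0` of the supply frame `L` (input `hμL` of the self-dual tower kernel), and ♭B′°'s DEGREE clause carries «`L` has first unit
coefficient at `m`» — hence `[Tᵐ]L ∈ R₀ˣ` — as a HYPOTHESIS (vacuous at `μ > 0` by design; the twin's `μ = 0` is item 20400). So the
tower kernel runs on the clause's own hypothesis and ♭B′° follows from the two remaining stubs:

* `stub_pubMembersFramesCongruence` := `Castella2018.castella2020_thm211_members_frames_sigma_congruence_odd_nonsplit_wt` (item 23284, PUB BY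
  NAME) — v16 VERBATIM.
* `stub_selfDualMemberRationalInclusionAtThree` := K1♯† (item 23310 `TwinSelfDualMemberRationalInclusionAtThree`, RESEARCH) — v16 VERBATIM.

Composition: `TwinDegreeFrameAtThreeMultTresT_of` :=
`…TwinDegreeFrameAtThreeMultTresTOfSelfDualMemberTower.twinDegreeFrameAtThreeMultTresT_of_nonsplitWtMembersFrames_of_selfDualMemberRationalInclusion`
(p680907 §2 = (4)† with the frame from the supply alone ∘ `degreeClause_of_wanClause`). lean rc 0 expected with exactly 2 sorries (the
stubs); the crux concluded BY NAME. SCOPE: this is the line of 22539 ONLY — the stronger intermediate ♭B′ `TwinWanFrameAtThreeMultTresT`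
(27401; rational inclusion needs `μ(L) = 0` unconditionally) keeps v16 with its three stubs, and `stub_thmB` remains registered THERE
(and is the content of 20400 `TwinMuZeroAtThree`). BSD is not proved by any of this; every `sorry` below is a stub.
[cite: Castella2018Erratum, §2 (p. 2), proof of Thm. 1.1 (a)(b)(c)] [cite: Skinner2016PacificMC, §2.6 (2-6-1), §3.1] [cite: Castella2020JIMJ, Thm. 2.11]
[cite: YanZhu2026, Thm. 4.4, Thm. 4.7, Thm. 5.7 (1)]
-/

noncomputable section

open scoped Classical

set_option linter.dupNamespace false
set_option autoImplicit false

namespace Summit.BirchSwinnertonDyer.BirchSwinnertonDyer.Cruxes.TwinDegreeFrameAtThreeMultTresT.MemberTower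

open PowerSeries WeierstrassCurve NumberField IsDedekindDomain Field
  Literature.NumberTheory.EllipticCurves
  Literature.NumberTheory.EllipticCurves.ModularForms
  Literature.NumberTheory.EllipticCurves.Rank1Residual
  Literature.NumberTheory.EllipticCurves.BigGaloisRep
  Literature.NumberTheory.EllipticCurves.GreenbergSelmer
  Literature.NumberTheory.GaloisRepresentations
  Summit.BirchSwinnertonDyer.Rank1Residual.X11b
  Summit.BirchSwinnertonDyer.Rank1Residual.X11b.Halves
  Summit.BirchSwinnertonDyer.BirchSwinnertonDyer.Theorems.SchneiderFree
  Summit.BirchSwinnertonDyer.BirchSwinnertonDyer.Theses.UniversalToricDescent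

/-- STUB (BY NAME = item stmt-BirchSwinnertonDyer-23284 `TwinCastellaMembersFramesCongruenceOddInput` at route rev 72, the
weight-sharpened supply 22593†; PUBLISHED by reading; closes only by formalisation): Castella JIMJ 2020 §2 Def. 2.10 / Thm. 2.11 at
an odd prime WITH the erratum's hypothesis (iii), members chosen with `2(p−1)p^{m−1} ∣ k_m − 2` (free in print: Skinner 2016 §2.6).
[cite: Castella2020JIMJ, §2 Def. 2.10, Thm. 2.11] [cite: Castella2018Erratum, Thm. 1.1 (iii), proof (a)(b)] [cite: Skinner2016PacificMC, §2.6 (2-6-1), §3.1] -/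
theorem stub_pubMembersFramesCongruence :
    Castella2018.castella2020_thm211_members_frames_sigma_congruence_odd_nonsplit_wt := by
  sorry

/-- STUB (RESEARCH, v17 = v16 = **K1♯†** = item stmt-BirchSwinnertonDyer-23310 `TwinSelfDualMemberRationalInclusionAtThree` VERBATIM, hardest stub; the pen's restated K1-at-3 text v2 fc46e6da7466964a VERBATIM). For every twin `W′`
multiplicative at `3` with `ρ̄₃` onto, all-split Heegner `K` of odd discriminant, anticyclotomic `κ` with generator `γ`, degree-one `𝔭 ∣ 3`
with the other slot `𝔭′`, branch-compatible `ι′`: for every depth `m ≥ 1`, every Hida member `D` with `2(3−1)3^{m−1} ∣ k_m − 2` and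
`ρ̄` irreducible, `ι′`-compatible, every characterised receptacle `b`, every Σ-frame `(Ω_K ≠ 0, Ω_p ∈ 𝓞_{ℂ₃}ˣ, Q)` of `D.g`:
`X^Σ_ac(A†_{g_m}; 𝔭′)` torsion ⟹ `∃ e, (3^e)·Ch(X^Σ_ac(A†_{g_m}))·𝓞_{ℂ₃}⟦T⟧ ⊆ (Q)`, with `A†_{g_m} = D.Δ.selfDualCofreeRepOver K` the SELF-DUAL
Tate twist (the erratum's `A_g`). Intended engine: the weight-`k_m` PORT of [YanZhu2026, Thm. 4.4 → 4.7 → 5.7 (1)] at `p = 3`, read on `A†`;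
no printed statement at `p = 3`. [cite: Castella2018Erratum, §2 (p. 2), (2.5)] [cite: YanZhu2026, §4.1, Thm. 4.2, Thm. 4.4, Thm. 4.7, Thm. 5.7 (1)]
[cite: SkinnerUrban2014, Thm. 7.7, Prop. 13.6 (1)] [cite: KingsLoefflerZerbes2017, Thm. B, §7.2] -/
theorem stub_selfDualMemberRationalInclusionAtThree :
    ∀ (W' : WeierstrassCurve ℚ) [W'.IsElliptic] [W'.IsGloballyMinimal] (N' : ℕ) [NeZero N'] (K : Type) [Field K] [NumberField K] (Dt' : Literature.NumberTheory.EllipticCurves.ModularForms.ModularParametrizationData W' N'), Literature.NumberTheory.EllipticCurves.Rank1Residual.Mult W' 3 → W'.HasSurjectiveModNGaloisRep 3 → W'.conductorNorm ℤ = N' → Literature.NumberTheory.EllipticCurves.IsImaginaryQuadratic K → Literature.NumberTheory.EllipticCurves.SatisfiesHeegnerHypothesis N' K → Odd (NumberField.discr K) → ∀ (κ : Literature.NumberTheory.EllipticCurves.ZpExtension K 3), κ.IsAnticyclotomic → ∀ (γ : Field.absoluteGaloisGroup K) [Fact (κ.IsTopGenerator γ)] (𝔭 : IsDedekindDomain.HeightOneSpectrum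 (NumberField.RingOfIntegers K)), ((3 : ℕ) : NumberField.RingOfIntegers K) ∈ 𝔭.asIdeal → 𝔭.asIdeal.ramificationIdx (NumberField.RingOfIntegers ℚ) = 1 → 𝔭.asIdeal.inertiaDeg (NumberField.RingOfIntegers ℚ) = 1 → ∀ (𝔭' : IsDedekindDomain.HeightOneSpectrum (NumberField.RingOfIntegers K)), ((3 : ℕ) : NumberField.RingOfIntegers K) ∈ 𝔭'.asIdeal → 𝔭' ≠ 𝔭 → ∀ (ι' : PadicAlgCl 3 ≃+* ℂ), Summit.BirchSwinnertonDyer.BirchSwinnertonDyer.Theorems.SchneiderFree.BranchInducesPrime 3 ι' 𝔭 → ∀ (m : ℕ), 1 ≤ m → ∀ (D : Literature.NumberTheory.EllipticCurves.Skinner2016.HidaCongruentMember W' 3 m), (2 * (((3 : ℕ) : ℤ) - 1) * ((3 : ℕ) : ℤ) ^ (m - 1)) ∣ D.k - 2 → Literature.NumberTheory.EllipticCurves.SkinnerUrban2014.IsResiduallyIrreducible D.Δ → (∀ x : Literature.NumberTheory.EllipticCurves.ModularForms.coeffField D.g, ι' (D.ι x) = (x : ℂ)) → ∀ (b : Literature.NumberTheory.EllipticCurves.GreenbergSelmer.padicCoeffIntegers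 D.ι →+* 𝓞_ℂ_[3]), (∀ x, ((b x : 𝓞_ℂ_[3]) : ℂ_[3]) = algebraMap (PadicAlgCl 3) ℂ_[3] (Literature.NumberTheory.EllipticCurves.GreenbergSelmer.padicCoeffIntegers.toPadicAlgCl D.ι x)) → ∀ (ΩK : ℂ) (Ωp : (𝓞_ℂ_[3])ˣ) (Q : PowerSeries 𝓞_ℂ_[3]), ΩK ≠ 0 → Literature.NumberTheory.EllipticCurves.IsBDPLFunctionWtSigmaInt ι' 𝔭 κ γ D.g (W'.sigmaPlacesFinset 3 K) ΩK ((Ωp : 𝓞_ℂ_[3]) : ℂ_[3]) Q → ∀ [TopologicalSpace (PowerSeries (Literature.NumberTheory.EllipticCurves.GreenbergSelmer.padicCoeffIntegers D.ι))] [ContinuousSMul (PowerSeries (Literature.NumberTheory.EllipticCurves.GreenbergSelmer.padicCoeffIntegers D.ι)) (Literature.NumberTheory.EllipticCurves.BigRepModule (Literature.NumberTheory.EllipticCurves.GreenbergSelmer.padicCoeffIntegers D.ι) 3 (Literature.NumberTheory.EllipticCurves.GreenbergSelmer.Cofree D.Δ.selfDualRep (Literature.NumberTheory.EllipticCurves.GreenbergSelmer.padicCoeffField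 D.ι)))], Module.IsTorsion (PowerSeries (Literature.NumberTheory.EllipticCurves.GreenbergSelmer.padicCoeffIntegers D.ι)) (Literature.NumberTheory.EllipticCurves.BigGaloisRep.XBig κ (D.Δ.selfDualCofreeRepOver K) 𝔭' (↑(W'.sigmaPlacesFinset 3 K))) → ∃ e : ℕ, Ideal.span {(PowerSeries.C ((3 : ℕ) : 𝓞_ℂ_[3]) : PowerSeries 𝓞_ℂ_[3]) ^ e} * (Literature.NumberTheory.EllipticCurves.BigGaloisRep.XBig.charIdeal κ (D.Δ.selfDualCofreeRepOver K) 𝔭' (↑(W'.sigmaPlacesFinset 3 K))).map (PowerSeries.map b) ≤ Ideal.span {Q} := by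
  sorry

/-- COMPOSITION (v17, act DEG): the degree-only twin crux of record ♭B′° `TwinDegreeFrameAtThreeMultTresT` (item
stmt-BirchSwinnertonDyer-22539) BY NAME from the TWO stubs, through the landed Thm-B-free kernel p680907 §2
(`twinDegreeFrameAtThreeMultTresT_of_nonsplitWtMembersFrames_of_selfDualMemberRationalInclusion`: supply frame, (dec) from the
très-ramifié binder, `μ(L) = 0` from the clause's own profile hypothesis, self-dual member tower, `degreeClause_of_wanClause`). [folklore] -/
theorem TwinDegreeFrameAtThreeMultTresT_of :
    Summit.BirchSwinnertonDyer.BirchSwinnertonDyer.Theses.UniversalToricDescent.TwinDegreeFrameAtThreeMultTresT :=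
  Summit.BirchSwinnertonDyer.BirchSwinnertonDyer.Theorems.UniversalToricDescentTwinDegreeFrameAtThreeMultTresTOfSelfDualMemberTower.twinDegreeFrameAtThreeMultTresT_of_nonsplitWtMembersFrames_of_selfDualMemberRationalInclusion
    stub_pubMembersFramesCongruence stub_selfDualMemberRationalInclusionAtThree

end Summit.BirchSwinnertonDyer.BirchSwinnertonDyer.Cruxes.TwinDegreeFrameAtThreeMultTresT.MemberTower

end
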